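import Literature.NumberTheory.EllipticCurves.IwasawaSelmerControlLocalizationProofs
import Literature.NumberTheory.EllipticCurves.IwasawaSelmerControlKernelProofs
import HarnessLib

/-!
# Mazur's control theorem: the local inputs of Greenberg's Lemma 3.5

Sibling proof file of `Literature.NumberTheory.EllipticCurves.IwasawaSelmerControl` (statement files
untouched; **no definition and no named fact is introduced**, everything below is proved). It
continues the localisation step `IwasawaSelmerControlLocalizationProofs` of the one remaining named
fact of the control theorem, `WeierstrassCurve.Greenberg1999_kerG_bounded` (Greenberg, LNM 1716,
§3, Lemma 3.5, p. 90 of the held copy `book:coatesnd-arithmetic-theory-elliptic-curves`: "The order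
of `ker(g_n)` is bounded as `n` varies"), and records — as the outcome of the D-0026 review of that
fact (2026-08-15; verdict: the fact is faithful to the source and stays as it is, to be discharged
inline) — the route to its discharge, carrying it down to the point where only the local
arithmetic of `E` over the completions enters.

## What is proved here

1. **Completely split places contribute nothing.**
   `exists_forall_finite_kerG_and_card_le_of_localKernelBounds` (file `…LocalizationProofs`)
   derives Lemma 3.5 from three local inputs: (h0) the `p`-power torsion `𝒦_{v,n}[p^∞]` of the
   local tower kernels (`localTowerKerPrimary`) vanishes for the finite places `v ∉ S`; (hC) it is
   finite of order `≤ C_v`, uniformly in `n`, for `v ∈ S`; (hD) no `v ∈ S` splits completely in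
   `K_∞/K`. Input (hD) is superfluous: a place that splits completely (`Γ_{K_v} → Γ_K` lands in
   `Gal(K̄/K_∞) = ker κ`) has `H_{v,∞} = H_{v,n} = Γ_{K_v}`, hence `𝒦_{v,n} = 0` for every `n`
   (`localTowerKer_eq_bot_of_forall_mem`; Greenberg's argument for the archimedean places, p. 86:
   "`v` splits completely in `F_∞/F`, i.e., `F_v = K_η`. Thus, `ker(r_{v_n}) = 0`"), so it may be
   removed from `S`: `exists_forall_finite_kerG_and_card_le_of_localTowerKerBounds`,
   `Greenberg1999_kerG_bounded_of_localTowerKerBounds` (inputs (h0), (hC) only).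
2. **Local inflation–restriction.** For a `K`-field `E` (a completion `K_v`) let
   `H_{E,n} = (Γ_E → Γ_K)⁻¹(Gal(K̄/K_n)) ⊇ H_{E,∞} = (Γ_E → Γ_K)⁻¹(Gal(K̄/K_∞))` and
   `M_∞ = E(K̄_E)^{H_{E,∞}}` (`= E(K_{∞,η})`). The quotient `H_{E,n}/H_{E,∞}` (`≅ κ(H_{E,n})`, a
   closed subgroup of `pⁿℤ_p`) is topologically cyclic: there is `g ∈ H_{E,n}` such that every open
   subgroup of `Γ_E` containing `H_{E,∞}` and `g` contains `H_{E,n}`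
   (`ZpExtension.exists_mem_localSubgroup_generate`; "`Γ_{v_n} = Gal(K/(F_n)_{v_n})` … topologically
   generated by `γ_{v_n}`", p. 87). For any such `g`,
   `𝒦_{E,n}[p^∞] ↪ (M_∞/(g - 1)M_∞)[p^∞]` (`finite_localTowerKerPrimary_and_card_le`): the
   inflation–restriction embedding `ker(res) ↪ M^N/(γ - 1)M^N` of `IwasawaCoinvariantsRankProofs`
   (`ResKernel.finite_subgroupResKer`), here upgraded to an injective *additive* map
   (`ResKernel.exists_addMonoidHom_subgroupResKer_injective`) so that it respects `p`-power
   torsion (`ResKernel.finite_primary_subgroupResKer_and_card_le`), applied to the topological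
   group `H_{E,n}`, its normal subgroup `H_{E,∞}` and `g` exactly as for Lemma 3.1
   (`finite_ker_layerToInfty_and_card_le`); `E(K̄_E)` is a discrete `Γ_E`-module
   (`continuous_smul_localPoints`). This is Greenberg's "`ker(r_{v_n}) ≅ H¹(Γ_{v_n}, ·) ≅
   (·)/(γ_{v_n} - 1)(·)`" (proof of Lemma 3.3, p. 87; of Lemma 3.4, p. 89) in
   `E(K̄_v)`-coefficients.
3. **Handoff.** `Greenberg1999_kerG_bounded_of_coinvariantBounds`: the named fact follows once,
   under its standing hypotheses, `(M_v/(g - 1)M_v)[p^∞]` is trivial for `v` off a finite set `S`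
   and of order `≤ C_v` for `v ∈ S`, for all `n` and all topological generators `g` of
   `H_{v,n}/H_{v,∞}`.

## What remains for `Greenberg1999_kerG_bounded_holds` (review record; D-0026: inline, no new facts)

With `Σ₀ = {v ∣ p} ∪ {v : bad reduction}` (p. 90) the hypotheses of
`Greenberg1999_kerG_bounded_of_coinvariantBounds` are exactly Greenberg's Lemmas 3.3 and 3.4, as
statements about the `Γ_{K_v}`-module `E(K̄_v)` alone:

* *Lemma 3.3 (`v ∤ p`, pp. 86–88).* With `B_v = M_v[p^∞] = E[p^∞]^{H_{v,∞}} ⊆ E[p^∞]` and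
  `N_v = M_v/B_v`: `#(M_v/(g-1)M_v)[p^∞] ≤ #(B_v/(g-1)B_v) · #(N_v/(g-1)N_v)[p^∞]`. The first
  factor is bounded uniformly in `n` by `PrimaryGroup.exists_card_quotient_range_le`
  (`PrimaryGroupStableImage`, as in Lemma 3.1; eq. (4), p. 87) once `ker(g - 1 ∣ B_v)` — the
  `p`-power torsion of `E(K_{n,w})`, as `H_{v,∞}` and `g` generate `H_{v,n}` — is finite; the
  second vanishes once `M_v ⊗ ℚ_p/ℤ_p = 0` (Prop. 2.1, p. 72: `Im κ_η = 0` for `η ∤ p`; then `N_v`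
  is uniquely `p`-divisible). For good `v ∤ p` (input (h0), p. 87): `I_v ≤ H_{v,∞}`
  (`χ_p(I_v) = 1`, `smul_eq_of_mem_absInertia_of_pow_eq`), `E[p^∞]` is unramified at `v`
  (`smul_geomPoints_baseChange_eq_of_mem_localInertia`, file `LocalH1TateDualityLangTateProofs`),
  `H_{v,∞}/I_v` acts on `E[p^∞]` through finite quotients of order prime to `p`
  (`χ_p(Frob_v) = N(v)` is not torsion; `FrobeniusGeneration`,
  `HasseWeilGoodReductionFrobeniusProofs.isArithFrobAt_resGalOfEmb`,
  `CyclotomicCharacterReductionProofs`), so `B_v = E[p^∞]^Δ` is divisible (average over `Δ`) and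
  `(g - 1)B_v = B_v`. **Missing local input (the size driver):** the Lutz–Mattuck structure of
  `E(K_{n,w})` for the finite extensions `K_{n,w}/K_v` of unbounded degree (finite `p`-power
  torsion; `E(L) ⊗ ℚ_p/ℤ_p = 0` for residue characteristic `ℓ ≠ p`), which the tree has over
  `ℚ_p` only (`exists_finiteIndex_addEquiv_padicInt_holds`, `PadicPointsFiltration*`): the formal
  group and the reduction map over a general non-archimedean local field are not in Mathlib.
* *Lemma 3.4 (`v ∣ p`, good ordinary, p. 89).* `#ker(r_{v_n}) = #Ẽ(f_{v_n})(p)²`, from the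
  reduction sequence `0 → C_v → E[p^∞] → Ẽ[p^∞] → 0` of the formal group at `v`, Props. 2.2 and
  2.4 (`Im κ = Im λ_div` over `K_{n,w}`; `Im κ_η = Im λ_η` over the deeply ramified `K_{∞,η}`,
  Coates–Greenberg 1996), Prop. 2.5, and `H²(M, C_v) = 0` (local duality; in the tree only the
  unproved fact `tateLocalDuality_quotient_equiv_torsionBy`). This is the XL part.

## References

* [GreenbergLNM1716] R. Greenberg, *Iwasawa theory for elliptic curves*, LNM 1716 (1999), §3:
  p. 86 (archimedean / completely split primes, `r_{v_n}`), pp. 86–88 (Lemma 3.3; `Γ_{v_n}`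
  topologically cyclic, p. 87), p. 89 (Lemma 3.4), p. 90 (Lemma 3.5 and its proof); §2, p. 72
  (Prop. 2.1).
* J.-P. Serre, *Galois Cohomology* (1997), I.§2.6 (inflation–restriction), II.§1 (discrete
  modules).
* [MazurInvent1972] B. Mazur, Invent. Math. 18 (1972), 183–266, §6.
-/

noncomputable section

open scoped Classical

universe u

/-! ## Inflation–restriction as an additive embedding (generic) -/

namespace Literature.NumberTheory.EllipticCurves.ResKernel

open Literature.NumberTheory.GaloisRepresentations

variable {G : Type u} [Group G] [TopologicalSpace G] [IsTopologicalGroup G]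
variable (N : Subgroup G)
variable (M : Type u) [AddCommGroup M] [DistribMulAction G M] [TopologicalSpace M]
  [DiscreteTopology M]

/-- **The value at `γ` is independent of the representative.** Two cocycles vanishing on the
normal subgroup `N` with the same class in `H¹(G, M)` differ by the coboundary of an element
`v ∈ M^N`, so their values at `γ` agree modulo `(γ - 1)M^N`. Serre, *Galois Cohomology*, I.§2.6
(inflation–restriction), I.§5.1; Greenberg (1999), §3, proof of Lemma 3.1. [folklore] -/
theorem mk_apply_eq_of_oneCocycleClass_eq [N.Normal] (γ : G)
    (φ ψ : contOneCocycles (discreteTopRep G M)) (hφ : ∀ n ∈ N, φ.1 n = 0)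
    (hψ : ∀ n ∈ N, ψ.1 n = 0) (h : oneCocycleClass _ φ = oneCocycleClass _ ψ) :
    (QuotientAddGroup.mk ⟨φ.1 γ, apply_mem_fixedPoints N M φ hφ γ⟩ :
        FixedPoints.addSubgroup N M ⧸ (subOne N M γ).range) =
      QuotientAddGroup.mk ⟨ψ.1 γ, apply_mem_fixedPoints N M ψ hψ γ⟩ := by
  have h0 : oneCocycleClass _ (φ - ψ) = 0 := by rw [oneCocycleClass_sub, h, sub_self]
  obtain ⟨v, hv⟩ := (oneCocycleClass_eq_zero_iff _ _).mp h0
  have hv' : ∀ g : G, φ.1 g - ψ.1 g = g • v - v := fun g ↦ by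
    have := hv g
    rw [Submodule.coe_sub, ContinuousMap.sub_apply] at this
    exact this
  have hvN : v ∈ FixedPoints.addSubgroup N M := by
    intro n
    have := hv' n
    rw [hφ n n.2, hψ n n.2, sub_self, eq_comm, sub_eq_zero] at this
    exact this
  rw [QuotientAddGroup.eq_iff_sub_mem]
  exact ⟨⟨v, hvN⟩, Subtype.ext (by
    simp only [coe_subOne_apply, AddSubgroupClass.coe_sub]
    exact (hv' γ).symm)⟩

/-- **The inflation–restriction embedding as an additive map.** When `N` and `γ` generate `G`
topologically, the kernel `subgroupResKer M N` of `res : H¹(G, M) → H¹(N, M)` maps additively and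
injectively to `M^N/(γ - 1)M^N` by `[φ] ↦ φ(γ)` for a representative `φ` vanishing on `N`
(`ResKernel.finite_subgroupResKer` is the cardinality statement of this embedding).
Serre, *Galois Cohomology*, I.§2.6 and XIII.§1; Greenberg (1999), §3, proof of Lemma 3.1
("`ker(h_n) ≅ H¹(Γ_n, B) = B/(γ^{pⁿ} - 1)B`", p. 86). [cite: GreenbergLNM1716, §3 Lemma 3.1] -/
theorem exists_addMonoidHom_subgroupResKer_injective [N.Normal] (γ : G)
    (hgen : ∀ U : Subgroup G, IsOpen (U : Set G) → N ≤ U → γ ∈ U → U = ⊤)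
    (hcont : ∀ m : M, Continuous fun g : G ↦ g • m) :
    ∃ w : subgroupResKer M N →+ FixedPoints.addSubgroup N M ⧸ (subOne N M γ).range,
      Function.Injective w ∧
        ∀ (x : subgroupResKer M N) (ψ : contOneCocycles (discreteTopRep G M))
          (hψ : ∀ n ∈ N, ψ.1 n = 0), oneCocycleClass _ ψ = (x : discreteH1 G M) →
          w x = QuotientAddGroup.mk ⟨ψ.1 γ, apply_mem_fixedPoints N M ψ hψ γ⟩ := by
  choose φ hφ hφN using fun x : subgroupResKer M N ↦
    exists_cocycle_of_res_eq_zero N M hcont x.1 x.2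
  let w₀ : subgroupResKer M N → FixedPoints.addSubgroup N M ⧸ (subOne N M γ).range := fun x ↦
    QuotientAddGroup.mk ⟨(φ x).1 γ, apply_mem_fixedPoints N M (φ x) (hφN x) γ⟩
  have hw₀ : ∀ (x : subgroupResKer M N) (ψ : contOneCocycles (discreteTopRep G M))
      (hψ : ∀ n ∈ N, ψ.1 n = 0), oneCocycleClass _ ψ = (x : discreteH1 G M) →
      w₀ x = QuotientAddGroup.mk ⟨ψ.1 γ, apply_mem_fixedPoints N M ψ hψ γ⟩ :=
    fun x ψ hψ hx ↦ mk_apply_eq_of_oneCocycleClass_eq N M γ (φ x) ψ (hφN x) hψ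
      ((hφ x).trans hx.symm)
  have hzero : w₀ 0 = 0 := by
    rw [hw₀ 0 0 (fun _ _ ↦ rfl) (by rw [oneCocycleClass_zero]; rfl)]
    rw [QuotientAddGroup.eq_zero_iff]
    exact ⟨0, Subtype.ext (by simp)⟩
  have hadd : ∀ x y : subgroupResKer M N, w₀ (x + y) = w₀ x + w₀ y := by
    intro x y
    have hN : ∀ n ∈ N, (φ x + φ y).1 n = 0 := fun n hn ↦ by
      rw [Submodule.coe_add, ContinuousMap.add_apply, hφN x n hn, hφN y n hn, add_zero]
    rw [hw₀ (x + y) (φ x + φ y) hN (by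
      rw [oneCocycleClass_add, hφ x, hφ y]; rfl)]
    rw [← QuotientAddGroup.mk_add]
    congr 1
  refine ⟨{ toFun := w₀, map_zero' := hzero, map_add' := hadd }, ?_, fun x ψ hψ hx ↦ hw₀ x ψ hψ hx⟩
  intro x y hxy
  change w₀ x = w₀ y at hxy
  obtain ⟨b, hb⟩ := QuotientAddGroup.eq_iff_sub_mem.mp hxy.symm
  have hval := congrArg (fun z : FixedPoints.addSubgroup N M ↦ (z : M)) hb
  simp only [coe_subOne_apply, AddSubgroupClass.coe_sub] at hval
  apply Subtype.ext
  rw [← hφ x, ← hφ y]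
  exact (oneCocycleClass_eq_of_sub_eq N M γ hgen hcont (φ y) (φ x) (hφN y) (hφN x) b.2
    hval.symm).symm

/-- **The `p`-power torsion of `ker(res)` embeds into the `p`-power torsion of the coinvariants.**
Under the hypotheses of `exists_addMonoidHom_subgroupResKer_injective`, the classes of
`subgroupResKer M N` killed by a power of `p` are at most as many as the elements of
`M^N/(γ - 1)M^N` killed by a power of `p` (`AddCommGroup.primaryComponent`), whenever the latter
are finitely many. Greenberg (1999), §3, proofs of Lemmas 3.1 and 3.3 (`ker(r_{v_n}) ≅ H¹(Γ_{v_n}, ·)`,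
pp. 86–87). [cite: GreenbergLNM1716, §3 Lemma 3.3 (proof, p. 87)] -/
theorem finite_primary_subgroupResKer_and_card_le [N.Normal] (γ : G)
    (hgen : ∀ U : Subgroup G, IsOpen (U : Set G) → N ≤ U → γ ∈ U → U = ⊤)
    (hcont : ∀ m : M, Continuous fun g : G ↦ g • m) (p : ℕ)
    [Finite (AddCommGroup.primaryComponent
      (FixedPoints.addSubgroup N M ⧸ (subOne N M γ).range) p)] :
    Finite {x : subgroupResKer M N // ∃ k : ℕ, p ^ k • x = 0} ∧
      Nat.card {x : subgroupResKer M N // ∃ k : ℕ, p ^ k • x = 0} ≤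
        Nat.card (AddCommGroup.primaryComponent
          (FixedPoints.addSubgroup N M ⧸ (subOne N M γ).range) p) := by
  obtain ⟨w, hw, -⟩ := exists_addMonoidHom_subgroupResKer_injective N M γ hgen hcont
  let f : {x : subgroupResKer M N // ∃ k : ℕ, p ^ k • x = 0} →
      AddCommGroup.primaryComponent (FixedPoints.addSubgroup N M ⧸ (subOne N M γ).range) p :=
    fun x ↦ ⟨w x.1, by
      obtain ⟨k, hk⟩ := x.2
      exact (AddCommGroup.mem_primaryComponent).mpr ⟨k, by rw [← map_nsmul, hk, map_zero]⟩⟩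
  have hf : Function.Injective f := fun x y hxy ↦ Subtype.ext (hw (Subtype.ext_iff.mp hxy))
  exact ⟨Finite.of_injective f hf, Nat.card_le_card_of_injective f hf⟩

end Literature.NumberTheory.EllipticCurves.ResKernel

/-! ## `E(K̄_E)` is a discrete `Γ_E`-module -/

namespace Literature.NumberTheory.EllipticCurves

variable {K : Type u} [Field K] (W : WeierstrassCurve K) (E : Type u) [Field E] [Algebra K E]

/-- **Stabilisers of local points are open.** The stabiliser in `Γ_E = Gal(K̄_E/E)` of a point of
`E(K̄_E)` (`localPoints W E`) contains `Gal(K̄_E/E(P))` with `E(P)/E` finite, hence is open for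
the Krull topology (same proof as `WeierstrassCurve.isOpen_stabilizer_point_holds` for `E(K̄)`).
Serre, *Galois Cohomology*, II.§1; Silverman, *AEC*, VIII.§1. [folklore] -/
theorem isOpen_stabilizer_localPoints (P : localPoints W E) :
    IsOpen (MulAction.stabilizer (Field.absoluteGaloisGroup E) P :
      Set (Field.absoluteGaloisGroup E)) := by
  change (W.baseChange (AlgebraicClosure E)).toAffine.Point at P
  rcases P with (_ | ⟨x, y, h⟩)
  · convert isOpen_univ
    ext σ
    simp only [SetLike.mem_coe, MulAction.mem_stabilizer_iff, Set.mem_univ, iff_true]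
    exact smul_zero σ
  · let L : IntermediateField E (AlgebraicClosure E) := IntermediateField.adjoin E {x, y}
    haveI : FiniteDimensional E L :=
      IntermediateField.finiteDimensional_adjoin fun z _ ↦ Algebra.IsIntegral.isIntegral z
    apply Subgroup.isOpen_mono (H₁ := L.fixingSubgroup) ?_ L.fixingSubgroup_isOpen
    intro σ hσ
    rw [IntermediateField.mem_fixingSubgroup_iff] at hσ
    have hx : σ x = x := hσ x (IntermediateField.subset_adjoin E _ (by simp))
    have hy : σ y = y := hσ y (IntermediateField.subset_adjoin E _ (by simp))
    change WeierstrassCurve.Affine.Point.map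
        ((AlgEquiv.restrictScalars K (show AlgebraicClosure E ≃ₐ[E] AlgebraicClosure E from σ) :
            AlgebraicClosure E ≃ₐ[K] AlgebraicClosure E) :
          AlgebraicClosure E →ₐ[K] AlgebraicClosure E)
        (WeierstrassCurve.Affine.Point.some x y h) = WeierstrassCurve.Affine.Point.some x y h
    rw [WeierstrassCurve.Affine.Point.map_some]
    congr 1

/-- **`E(K̄_E)` is a discrete `Γ_E`-module**: the action is continuous for the discrete topology
(Mathlib's `continuousSMul_iff_stabilizer_isOpen`). Serre, *Galois Cohomology*, II.§1. [folklore] -/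
theorem continuousSMul_localPoints :
    ContinuousSMul (Field.absoluteGaloisGroup E) (localPoints W E) :=
  continuousSMul_iff_stabilizer_isOpen.mpr (isOpen_stabilizer_localPoints W E)

/-- The orbit map `σ ↦ σ • P` of a local point is continuous. Serre, *Galois Cohomology*, II.§1.
[folklore] -/
theorem continuous_smul_localPoints (P : localPoints W E) :
    Continuous fun σ : Field.absoluteGaloisGroup E ↦ σ • P := by
  haveI := continuousSMul_localPoints W E
  exact continuous_id.smul continuous_const

variable {p : ℕ} [Fact p.Prime] (κ : ZpExtension K p)

/-- The local subgroup `H_{E,n} = (Γ_E → Γ_K)⁻¹(Gal(K̄/K_n))` is open in `Γ_E` (preimage of the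
open subgroup `κ⁻¹(pⁿℤ_p)` under the continuous restriction). [folklore] -/
theorem isOpen_localSubgroup_layerSubgroup (n : ℕ) :
    IsOpen (localSubgroup (κ.layerSubgroup n) E : Set (Field.absoluteGaloisGroup E)) :=
  (κ.isOpen_layerSubgroup n).preimage (map_continuous (resGal (K := K) E))

end Literature.NumberTheory.EllipticCurves

/-! ## `H_{E,n}/H_{E,∞}` is topologically cyclic -/

namespace Literature.NumberTheory.EllipticCurves

variable {K : Type u} [Field K] [CharZero K] {p : ℕ} [Fact p.Prime] (κ : ZpExtension K p)
  (E : Type u) [Field E] [Algebra K E]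

/-- **The local layer quotients `H_{E,n}/H_{E,∞}` are topologically cyclic.** For every `n` there
is `g ∈ H_{E,n} = (Γ_E → Γ_K)⁻¹(Gal(K̄/K_n))` such that `H_{E,∞} = (Γ_E → Γ_K)⁻¹(Gal(K̄/K_∞))`
and `g` generate `H_{E,n}` topologically: every open subgroup `U` of `Γ_E` containing `H_{E,∞}`
and `g` contains `H_{E,n}`. Proof: if the local character `λ = κ ∘ (Γ_E → Γ_K)` vanishes on
`H_{E,n}`, take `g = 1`; otherwise take `g ∈ H_{E,n}` with `λ(g) = u p^m ≠ 0` of minimal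
valuation `m`, so that `λ(H_{E,n}) ⊆ p^m ℤ_p`. Then `λ(U ∩ H_{E,n})` is closed (continuous image
of a compact set) and contains `k u p^m` for all `k ∈ ℕ`, hence all of `p^m ℤ_p ⊇ λ(H_{E,n})`
(`ℕ` is dense in `ℤ_p`); so every `x ∈ H_{E,n}` has `λ(x) = λ(y)` with `y ∈ U ∩ H_{E,n}`, and
`x = (x y⁻¹) y ∈ H_{E,∞} U = U`. (For `E = K_v`: `Gal(K_{∞,η}/K_{n,w}) ≅ λ(H_{v,n})` is `0` or
`≅ ℤ_p`, "topologically generated by `γ_{v_n}`", Greenberg (1999), §3, p. 87.)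
[cite: GreenbergLNM1716, §3 Lemma 3.3 (proof, p. 87)] -/
theorem ZpExtension.exists_mem_localSubgroup_generate (n : ℕ) :
    ∃ g ∈ localSubgroup (κ.layerSubgroup n) E,
      ∀ U : Subgroup (Field.absoluteGaloisGroup E),
        IsOpen (U : Set (Field.absoluteGaloisGroup E)) → localSubgroup κ.kerSubgroup E ≤ U →
          g ∈ U → localSubgroup (κ.layerSubgroup n) E ≤ U := by
  haveI : CharZero E := charZero_of_injective_algebraMap (algebraMap K E).injective
  set Hn : Subgroup (Field.absoluteGaloisGroup E) := localSubgroup (κ.layerSubgroup n) E with hHn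
  set Hi : Subgroup (Field.absoluteGaloisGroup E) := localSubgroup κ.kerSubgroup E with hHi
  -- the local character `λ = κ ∘ (Γ_E → Γ_K)`, written additively
  let lam : Field.absoluteGaloisGroup E → ℤ_[p] := fun x ↦ (κ (resGal (K := K) E x)).toAdd
  have hlam_cont : Continuous lam :=
    continuous_toAdd.comp ((map_continuous κ).comp (map_continuous (resGal (K := K) E)))
  have hlam_pow : ∀ (x : Field.absoluteGaloisGroup E) (k : ℕ), lam (x ^ k) = k • lam x :=
    fun x k ↦ by
      show (κ (resGal (K := K) E (x ^ k))).toAdd = k • (κ (resGal (K := K) E x)).toAdd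
      rw [map_pow, map_pow, toAdd_pow]
  have hmemHi : ∀ x : Field.absoluteGaloisGroup E, x ∈ Hi ↔ lam x = 0 := fun x ↦ by
    rw [hHi, mem_localSubgroup_iff, ZpExtension.mem_kerSubgroup]
    constructor
    · intro h
      show (κ (resGal (K := K) E x)).toAdd = 0
      rw [h, toAdd_one]
    · intro h
      exact Multiplicative.toAdd.injective (by rw [toAdd_one]; exact h)
  by_cases htriv : ∀ x ∈ Hn, lam x = 0
  · -- `H_{E,n} = H_{E,∞}`: take `g = 1`
    refine ⟨1, one_mem _, fun U _ hU _ x hx ↦ hU ((hmemHi x).mpr (htriv x hx))⟩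
  · -- an element of `H_{E,n}` of minimal valuation
    simp only [not_forall] at htriv
    obtain ⟨x₀, hx₀, hne⟩ := htriv
    have hS : ∃ m : ℕ, ∃ x ∈ Hn, lam x ≠ 0 ∧ (lam x).valuation = m := ⟨_, x₀, hx₀, hne, rfl⟩
    classical
    obtain ⟨g, hg, hg0, hgv⟩ := Nat.find_spec hS
    have hmin : ∀ x ∈ Hn, lam x ≠ 0 → Nat.find hS ≤ (lam x).valuation :=
      fun x hx h ↦ Nat.find_min' hS ⟨x, hx, h, rfl⟩
    set m₀ := Nat.find hS with hm₀
    set ug : ℤ_[p]ˣ := PadicInt.unitCoeff hg0 with hug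
    have hgeq : lam g = (ug : ℤ_[p]) * (p : ℤ_[p]) ^ m₀ := by
      rw [← hgv]; exact PadicInt.unitCoeff_spec hg0
    -- `λ(H_{E,n}) ⊆ p^{m₀} ℤ_p`
    have hdiv : ∀ x ∈ Hn, ∃ z : ℤ_[p], lam x = (p : ℤ_[p]) ^ m₀ * z := by
      intro x hx
      by_cases h : lam x = 0
      · exact ⟨0, by rw [h, mul_zero]⟩
      · refine ⟨(PadicInt.unitCoeff h : ℤ_[p]) * (p : ℤ_[p]) ^ ((lam x).valuation - m₀), ?_⟩
        calc lam x = (PadicInt.unitCoeff h : ℤ_[p]) * (p : ℤ_[p]) ^ (lam x).valuation :=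
              PadicInt.unitCoeff_spec h
          _ = (PadicInt.unitCoeff h : ℤ_[p]) *
                ((p : ℤ_[p]) ^ m₀ * (p : ℤ_[p]) ^ ((lam x).valuation - m₀)) := by
              rw [← pow_add, Nat.add_sub_cancel' (hmin x hx h)]
          _ = (p : ℤ_[p]) ^ m₀ *
                ((PadicInt.unitCoeff h : ℤ_[p]) * (p : ℤ_[p]) ^ ((lam x).valuation - m₀)) := by
              ring
    refine ⟨g, hg, fun U hUopen hHiU hgU x hx ↦ ?_⟩
    -- `λ(U ∩ H_{E,n})` is closed and contains `ℕ · λ(g)`, hence `λ(x)`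
    set T : Set (Field.absoluteGaloisGroup E) :=
      (U : Set (Field.absoluteGaloisGroup E)) ∩ (Hn : Set (Field.absoluteGaloisGroup E)) with hT
    have hTclosed : IsClosed T :=
      (Subgroup.isClosed_of_isOpen U hUopen).inter
        (Subgroup.isClosed_of_isOpen _ (isOpen_localSubgroup_layerSubgroup E κ n))
    have himg : IsClosed (lam '' T) := ((hTclosed.isCompact).image hlam_cont).isClosed
    have hpow_mem : ∀ k : ℕ, (k : ℤ_[p]) * ((ug : ℤ_[p]) * (p : ℤ_[p]) ^ m₀) ∈ lam '' T :=
      fun k ↦ ⟨g ^ k, ⟨U.pow_mem hgU k, Hn.pow_mem hg k⟩, by rw [hlam_pow, hgeq, nsmul_eq_mul]⟩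
    obtain ⟨z, hz⟩ := hdiv x hx
    have hxmem : lam x ∈ lam '' T := by
      let F : ℤ_[p] → ℤ_[p] := fun t ↦ t * ((ug : ℤ_[p]) * (p : ℤ_[p]) ^ m₀)
      have hF : Continuous F := continuous_id.mul continuous_const
      have hw : z * ((ug⁻¹ : ℤ_[p]ˣ) : ℤ_[p]) ∈ closure (Set.range (Nat.cast : ℕ → ℤ_[p])) := by
        rw [PadicInt.denseRange_natCast.closure_range]; exact Set.mem_univ _
      have hcl : F (z * ((ug⁻¹ : ℤ_[p]ˣ) : ℤ_[p])) ∈ closure (lam '' T) :=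
        map_mem_closure hF hw (by rintro _ ⟨k, rfl⟩; exact hpow_mem k)
      rw [himg.closure_eq] at hcl
      have hFx : F (z * ((ug⁻¹ : ℤ_[p]ˣ) : ℤ_[p])) = lam x := by
        show z * ((ug⁻¹ : ℤ_[p]ˣ) : ℤ_[p]) * ((ug : ℤ_[p]) * (p : ℤ_[p]) ^ m₀) = lam x
        rw [hz, mul_assoc, ← mul_assoc ((ug⁻¹ : ℤ_[p]ˣ) : ℤ_[p]), Units.inv_mul, one_mul, mul_comm]
      rwa [hFx] at hcl
    obtain ⟨y, ⟨hyU, -⟩, hy⟩ := hxmem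
    -- `x y⁻¹ ∈ H_{E,∞} ⊆ U`
    have hxy : x * y⁻¹ ∈ Hi := by
      rw [hHi, mem_localSubgroup_iff, ZpExtension.mem_kerSubgroup, map_mul, map_mul, map_inv,
        map_inv, mul_inv_eq_one]
      exact (Multiplicative.toAdd.injective hy).symm
    have := U.mul_mem (hHiU hxy) hyU
    rwa [inv_mul_cancel_right] at this

end Literature.NumberTheory.EllipticCurves

/-! ## The local tower kernels embed into coinvariants -/

namespace WeierstrassCurve

open Literature.NumberTheory.EllipticCurves Literature.NumberTheory.GaloisRepresentations
  Literature.NumberTheory.EllipticCurves.ResKernel NumberField IsDedekindDomain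

variable {K : Type u} [Field K] (W : WeierstrassCurve K) {p : ℕ} [Fact p.Prime]
  (κ : ZpExtension K p)

section LocalTower

variable (E : Type u) [Field E] [Algebra K E]

/-- **Local inflation–restriction: `𝒦_{E,n}[p^∞]` embeds into `(M_∞/(g - 1)M_∞)[p^∞]`.** Let
`M_∞ = E(K̄_E)^{H_{E,∞}}` (the points over `K_∞ · E`, `FixedPoints.addSubgroup`) and let
`g ∈ H_{E,n}` be such that `H_{E,∞}` and `g` generate `H_{E,n}` topologically (every open subgroup
of `Γ_E` containing both contains `H_{E,n}`; such `g` exist, `exists_mem_localSubgroup_generate`).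
Then the `p`-power torsion of the local tower kernel
`𝒦_{E,n} = ker (H¹(H_{E,n}, E(K̄_E)) → H¹(H_{E,∞}, E(K̄_E)))` is finite, of order at most that of
the `p`-power torsion of the coinvariants `M_∞/(g - 1)M_∞`, whenever the latter is finite: the
generic embedding `ResKernel.finite_primary_subgroupResKer_and_card_le` for the topological group
`H_{E,n}`, its normal subgroup `H_{E,∞}` and `g`, transported along
`H_{E,∞}.subgroupOf H_{E,n} ≃ H_{E,∞}` (same fixed points, same `g - 1`) and the identification of
`𝒦_{E,n}` with the generic restriction kernel (`resH1Hom_comp`), exactly as for Lemma 3.1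
(`finite_ker_layerToInfty_and_card_le`). This is Greenberg's
"`ker(r_{v_n}) ≅ H¹(Γ_{v_n}, ·) ≅ (·)/(γ_{v_n} - 1)(·)`" (LNM 1716, §3, proof of Lemma 3.3, p. 87,
and of Lemma 3.4, p. 89) in `E(K̄_v)`-coefficients. [cite: GreenbergLNM1716, §3 Lemma 3.3 (proof, p. 87)] -/
theorem finite_localTowerKerPrimary_and_card_le (n : ℕ) {g : Field.absoluteGaloisGroup E}
    (hg : g ∈ localSubgroup (κ.layerSubgroup n) E)
    (hgen : ∀ U : Subgroup (Field.absoluteGaloisGroup E),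
      IsOpen (U : Set (Field.absoluteGaloisGroup E)) → localSubgroup κ.kerSubgroup E ≤ U →
        g ∈ U → localSubgroup (κ.layerSubgroup n) E ≤ U)
    [Finite (AddCommGroup.primaryComponent
      (FixedPoints.addSubgroup (localSubgroup κ.kerSubgroup E) (localPoints W E) ⧸
        (subOne (localSubgroup κ.kerSubgroup E) (localPoints W E) g).range) p)] :
    Finite (W.localTowerKerPrimary κ E n) ∧
      Nat.card (W.localTowerKerPrimary κ E n) ≤
        Nat.card (AddCommGroup.primaryComponent
          (FixedPoints.addSubgroup (localSubgroup κ.kerSubgroup E) (localPoints W E) ⧸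
            (subOne (localSubgroup κ.kerSubgroup E) (localPoints W E) g).range) p) := by
  -- notation
  let P : Type u := localPoints W E
  let Hn : Subgroup (Field.absoluteGaloisGroup E) := localSubgroup (κ.layerSubgroup n) E
  let Hi : Subgroup (Field.absoluteGaloisGroup E) := localSubgroup κ.kerSubgroup E
  let N : Subgroup Hn := Hi.subgroupOf Hn
  let γ : Hn := ⟨g, hg⟩
  have hle : Hi ≤ Hn := localSubgroup_ker_le_layer κ E n
  -- (1) `H_{E,∞}` and `g` generate `H_{E,n}` (inside the topological group `H_{E,n}`)
  have hgen' : ∀ U : Subgroup Hn, IsOpen (U : Set Hn) → N ≤ U → γ ∈ U → U = ⊤ := by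
    intro U hU hNU hγU
    let U' : Subgroup (Field.absoluteGaloisGroup E) := U.map Hn.subtype
    have hopen : IsOpen (U' : Set (Field.absoluteGaloisGroup E)) :=
      (isOpen_localSubgroup_layerSubgroup E κ n).isOpenMap_subtype_val _ hU
    have hN' : Hi ≤ U' := fun τ hτ ↦
      ⟨⟨τ, hle hτ⟩, hNU (Subgroup.mem_subgroupOf.mpr hτ), rfl⟩
    have hγU' : g ∈ U' := ⟨γ, hγU, rfl⟩
    have hle' := hgen U' hopen hN' hγU'
    rw [eq_top_iff]
    intro x _
    obtain ⟨u, hu, hux⟩ := hle' x.2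
    have : u = x := Subtype.ext hux
    exact this ▸ hu
  -- (2) orbit maps on `H_{E,n}` are continuous
  have hcont : ∀ m : P, Continuous fun x : Hn ↦ x • m := fun m ↦
    (continuous_smul_localPoints W E m).comp continuous_subtype_val
  -- (3) `P^N = P^{H_{E,∞}} = M_∞`, compatibly with `g - 1`
  have hfix : FixedPoints.addSubgroup N P = FixedPoints.addSubgroup Hi P := by
    ext m
    simp only [FixedPoints.mem_addSubgroup]
    constructor
    · intro h τ
      exact h ⟨⟨τ, hle τ.2⟩, Subgroup.mem_subgroupOf.mpr τ.2⟩
    · intro h x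
      exact h ⟨((x : Hn) : Field.absoluteGaloisGroup E), Subgroup.mem_subgroupOf.mp x.2⟩
  let e : FixedPoints.addSubgroup N P ≃+ FixedPoints.addSubgroup Hi P :=
    AddEquiv.addSubgroupCongr hfix
  have he : AddSubgroup.map (e : FixedPoints.addSubgroup N P →+ FixedPoints.addSubgroup Hi P)
      (subOne N P γ).range = (subOne Hi P g).range := by
    ext b
    constructor
    · rintro ⟨x, ⟨y, rfl⟩, rfl⟩
      exact ⟨e y, Subtype.ext rfl⟩
    · rintro ⟨y, rfl⟩
      exact ⟨subOne N P γ (e.symm y), ⟨e.symm y, rfl⟩, Subtype.ext rfl⟩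
  let eq : FixedPoints.addSubgroup N P ⧸ (subOne N P γ).range ≃+
      FixedPoints.addSubgroup Hi P ⧸ (subOne Hi P g).range :=
    QuotientAddGroup.congr _ _ e he
  let ep : AddCommGroup.primaryComponent (FixedPoints.addSubgroup N P ⧸ (subOne N P γ).range) p ≃
      AddCommGroup.primaryComponent (FixedPoints.addSubgroup Hi P ⧸ (subOne Hi P g).range) p :=
    eq.toEquiv.subtypeEquiv fun a ↦ by
      simp only [AddCommGroup.mem_primaryComponent, AddEquiv.toEquiv_eq_coe, EquivLike.coe_coe]
      constructor
      · rintro ⟨k, hk⟩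
        exact ⟨k, by rw [← map_nsmul, hk, map_zero]⟩
      · rintro ⟨k, hk⟩
        refine ⟨k, eq.injective ?_⟩
        rw [map_nsmul, hk, map_zero]
  haveI : Finite (AddCommGroup.primaryComponent
      (FixedPoints.addSubgroup N P ⧸ (subOne N P γ).range) p) := Finite.of_equiv _ ep.symm
  have hcardp : Nat.card (AddCommGroup.primaryComponent
      (FixedPoints.addSubgroup N P ⧸ (subOne N P γ).range) p) =
      Nat.card (AddCommGroup.primaryComponent
        (FixedPoints.addSubgroup Hi P ⧸ (subOne Hi P g).range) p) :=
    Nat.card_congr ep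
  -- (4) the generic embedding on `H_{E,n}`
  obtain ⟨hfinK, hcardK⟩ := finite_primary_subgroupResKer_and_card_le N P γ hgen' hcont p
  haveI := hfinK
  -- (5) `𝒦_{E,n} ⊆ ker (res : H¹(H_{E,n}, P) → H¹(N, P))`
  have hker : W.localTowerKer κ E n ≤ subgroupResKer P N := by
    intro c hc
    let j : N →ₜ* Hi :=
      { toFun := fun x ↦ ⟨((x : Hn) : Field.absoluteGaloisGroup E), Subgroup.mem_subgroupOf.mp x.2⟩
        map_one' := rfl
        map_mul' := fun _ _ ↦ rfl
        continuous_toFun :=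
          (continuous_subtype_val.comp continuous_subtype_val).subtype_mk _ }
    have hcomp : (resH1Hom j (AddMonoidHom.id P) (fun _ _ ↦ rfl)).comp
        (Literature.NumberTheory.EllipticCurves.resOfLe P hle) = resSubgroup N P := by
      unfold Literature.NumberTheory.EllipticCurves.resOfLe ResKernel.resSubgroup
      rw [resH1Hom_comp]
      exact resH1Hom_congr (ContinuousMonoidHom.ext fun _ ↦ rfl) (AddMonoidHom.ext fun _ ↦ rfl) _ _
    rw [mem_subgroupResKer_iff, ← hcomp, AddMonoidHom.comp_apply,
      (W.mem_localTowerKer_iff κ E n c).mp hc, map_zero]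
  -- (6) `𝒦_{E,n}[p^∞] ↪ {x ∈ ker res | p^k x = 0}`
  let f : W.localTowerKerPrimary κ E n → {x : subgroupResKer P N // ∃ k : ℕ, p ^ k • x = 0} :=
    fun c ↦ ⟨⟨(c : discreteH1 Hn P), hker c.2.1⟩, by
      obtain ⟨k, hk⟩ := c.2.2
      exact ⟨k, Subtype.ext hk⟩⟩
  have hf : Function.Injective f := fun a b hab ↦ by
    have h1 := congrArg (fun z ↦ ((z.1 : subgroupResKer P N) : discreteH1 Hn P)) hab
    exact Subtype.ext h1
  exact ⟨Finite.of_injective f hf,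
    (Nat.card_le_card_of_injective f hf).trans (hcardK.trans hcardp.le)⟩

end LocalTower

/-! ## Completely split places contribute nothing -/

section Tower

/-- `𝒦_{E,n}[p^∞] ≤ 𝒦_{E,n}` (the `p`-power torsion of the local tower kernel is part of it).
Greenberg (1999), §3, p. 86. [folklore] -/
theorem localTowerKerPrimary_le_localTowerKer (E : Type u) [Field E] [Algebra K E] (n : ℕ) :
    W.localTowerKerPrimary κ E n ≤ W.localTowerKer κ E n :=
  fun _ hx ↦ hx.1

/-- **A place that splits completely in `K_∞/K` has trivial local tower kernels**, `p`-power
torsion included: if `Γ_E → Γ_K` lands in `Gal(K̄/K_∞) = ker κ`, then `H_{E,∞} = H_{E,n} = Γ_E`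
and `𝒦_{E,n}[p^∞] ≤ 𝒦_{E,n} = 0` (`localTowerKer_eq_bot_of_forall_mem`). Greenberg (1999), §3,
p. 86 ("`v` splits completely in `F_∞/F`, i.e., `F_v = K_η`. Thus, `ker(r_{v_n}) = 0`").
[cite: GreenbergLNM1716, §3 p. 86] -/
theorem localTowerKerPrimary_eq_bot_of_forall_mem (E : Type u) [Field E] [Algebra K E] (n : ℕ)
    (h : ∀ τ : Field.absoluteGaloisGroup E, resGal (K := K) E τ ∈ κ.kerSubgroup) :
    W.localTowerKerPrimary κ E n = ⊥ :=
  le_bot_iff.mp ((W.localTowerKerPrimary_le_localTowerKer κ E n).trans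
    (W.localTowerKer_eq_bot_of_forall_mem κ E n h).le)

end Tower

/-! ## Lemma 3.5 from the local kernel bounds alone -/

section Selmer

variable [NumberField K]

/-- **Greenberg's Lemma 3.5 from the local kernel bounds (h0), (hC) alone.** As
`exists_forall_finite_kerG_and_card_le_of_localKernelBounds`, without the decomposition
hypothesis (hD): the places of `S` that split completely in `K_∞/K` have `𝒦_{v,n}[p^∞] = 0` for
all `n` (`localTowerKerPrimary_eq_bot_of_forall_mem`) and are discarded from `S`; the remaining
ones satisfy (hD) by definition, so the localisation theorem applies to the filtered set.
Conclusion: if `𝒦_{v,n}[p^∞] = 0` for `v ∉ S` and `#𝒦_{v,n}[p^∞] ≤ C_v` for `v ∈ S`, uniformly in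
`n`, then the orders `#(A_n / Sel_{p^∞}(E/K_n)) = #ker g_n` are bounded as `n` varies.
Greenberg (1999), §3, p. 90 (proof of Lemma 3.5) with p. 86 (completely split places).
[cite: GreenbergLNM1716, §3 Lemma 3.5 (proof, p. 90)] -/
theorem exists_forall_finite_kerG_and_card_le_of_localTowerKerBounds
    (S : Finset (HeightOneSpectrum (𝓞 K))) (C : HeightOneSpectrum (𝓞 K) → ℕ)
    (h0 : ∀ v ∉ S, ∀ n : ℕ, W.localTowerKerPrimary κ (v.adicCompletion K) n = ⊥)
    (hC : ∀ v ∈ S, ∀ n : ℕ, Finite (W.localTowerKerPrimary κ (v.adicCompletion K) n) ∧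
      Nat.card (W.localTowerKerPrimary κ (v.adicCompletion K) n) ≤ C v) :
    ∃ B : ℕ, ∀ n : ℕ,
      Finite (↥(W.selmerInftyPreimage κ n) ⧸
          (W.selmerLayer κ n).addSubgroupOf (W.selmerInftyPreimage κ n)) ∧
        Nat.card (↥(W.selmerInftyPreimage κ n) ⧸
          (W.selmerLayer κ n).addSubgroupOf (W.selmerInftyPreimage κ n)) ≤ B := by
  -- the places of `S` that do NOT split completely in `K_∞/K`
  let S' : Finset (HeightOneSpectrum (𝓞 K)) := S.filter fun v ↦
    ∃ δ : Field.absoluteGaloisGroup (v.adicCompletion K),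
      resGal (K := K) (v.adicCompletion K) δ ∉ κ.kerSubgroup
  refine W.exists_forall_finite_kerG_and_card_le_of_localKernelBounds κ S' C ?_ ?_ ?_
  · intro v hv n
    by_cases hvS : v ∈ S
    · -- `v ∈ S` splits completely: its local tower kernels vanish
      have hsplit : ∀ δ : Field.absoluteGaloisGroup (v.adicCompletion K),
          resGal (K := K) (v.adicCompletion K) δ ∈ κ.kerSubgroup :=
        fun δ ↦ by_contra fun hδ ↦ hv (Finset.mem_filter.mpr ⟨hvS, δ, hδ⟩)
      exact W.localTowerKerPrimary_eq_bot_of_forall_mem κ (v.adicCompletion K) n hsplit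
    · exact h0 v hvS n
  · intro v hv n
    exact hC v (Finset.mem_filter.mp hv).1 n
  · intro v hv
    exact (Finset.mem_filter.mp hv).2

/-- **Lemma 3.5 reduced to Lemmas 3.3 and 3.4.** The named fact `Greenberg1999_kerG_bounded`
(Greenberg, LNM 1716, §3, Lemma 3.5) follows from the two local kernel bounds under its standing
hypotheses (`E` elliptic, `K_∞/K` the cyclotomic `ℤ_p`-extension, good ordinary reduction above
`p`), for a finite set `S` of finite places (Greenberg's `Σ₀`: the primes above `p` or of bad
reduction, p. 90):
* (h0) `𝒦_{v,n}[p^∞] = 0` for `v ∉ S` and all `n` — Lemma 3.3, second part (p. 87: for good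
  `v ∤ p`, `B_v = E[p^∞]^Δ` is divisible, so `ker(r_{v_n}) = 0`);
* (hC) `#𝒦_{v,n}[p^∞] ≤ C_v` for `v ∈ S` and all `n` — Lemma 3.3, eq. (4) (bad `v ∤ p`, p. 87)
  and Lemma 3.4 (`v ∣ p`, p. 89).
The decomposition input of `Greenberg1999_kerG_bounded_of_localKernelBounds` ("the number of
primes of `F_n` lying over `v` is bounded", i.e. no `v ∈ S` splits completely) is not needed.
Neither (h0) nor (hC) is proved here (see the module docstring for what they require).
[cite: GreenbergLNM1716, §3 Lemma 3.5 (proof, p. 90)] -/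
theorem Greenberg1999_kerG_bounded_of_localTowerKerBounds
    (S : Finset (HeightOneSpectrum (𝓞 K))) (C : HeightOneSpectrum (𝓞 K) → ℕ)
    (h0 : ∀ [W.IsElliptic], κ.IsCyclotomic →
      (∀ v : HeightOneSpectrum (𝓞 K), (p : 𝓞 K) ∈ v.asIdeal →
        W.HasGoodReductionAt v ∧ W.HasUnitRootAt v) →
      ∀ v ∉ S, ∀ n : ℕ, W.localTowerKerPrimary κ (v.adicCompletion K) n = ⊥)
    (hC : ∀ [W.IsElliptic], κ.IsCyclotomic →
      (∀ v : HeightOneSpectrum (𝓞 K), (p : 𝓞 K) ∈ v.asIdeal →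
        W.HasGoodReductionAt v ∧ W.HasUnitRootAt v) →
      ∀ v ∈ S, ∀ n : ℕ, Finite (W.localTowerKerPrimary κ (v.adicCompletion K) n) ∧
        Nat.card (W.localTowerKerPrimary κ (v.adicCompletion K) n) ≤ C v) :
    W.Greenberg1999_kerG_bounded κ := by
  intro _ hκ hp
  exact W.exists_forall_finite_kerG_and_card_le_of_localTowerKerBounds κ S C (h0 hκ hp) (hC hκ hp)

/-! ## Handoff: Lemma 3.5 from bounds on the local coinvariants -/

/-- **Greenberg's Lemma 3.5 from bounds on the local coinvariants** (the form in which the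
remaining local inputs — Lemmas 3.3 and 3.4 of LNM 1716 — enter). For a finite place `v` write
`M_v = E(K̄_v)^{H_{v,∞}}` (`= E(K_{∞,η})`, `FixedPoints.addSubgroup (localSubgroup κ.kerSubgroup K_v)
(localPoints W K_v)`) and, for `g ∈ H_{v,n}` generating `H_{v,n}` modulo `H_{v,∞}` topologically,
`Q_{v,n,g} = M_v/(g - 1)M_v`. Suppose that under the standing hypotheses (`E` elliptic, `K_∞/K`
cyclotomic, good ordinary reduction above `p`), for a finite set `S` of finite places:
* (h0) for `v ∉ S`, all `n` and all such `g`, `Q_{v,n,g}` has no non-zero `p`-power torsion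
  (Lemma 3.3, second part: `B_v` divisible and `Im κ_η = 0`, p. 87);
* (hC) for `v ∈ S`, all `n` and all such `g`, `#Q_{v,n,g}[p^∞] ≤ C_v` (Lemma 3.3, eq. (4),
  p. 87, for bad `v ∤ p`; Lemma 3.4, p. 89, for `v ∣ p`).
Then `Greenberg1999_kerG_bounded` holds: `𝒦_{v,n}[p^∞] ↪ Q_{v,n,g}[p^∞]`
(`finite_localTowerKerPrimary_and_card_le`, with `g` from
`ZpExtension.exists_mem_localSubgroup_generate`), and Lemma 3.5 follows from the local kernel
bounds (`Greenberg1999_kerG_bounded_of_localTowerKerBounds`). Greenberg (1999), §3, pp. 86–90.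
[cite: GreenbergLNM1716, §3 Lemma 3.5 (proof, p. 90)] -/
theorem Greenberg1999_kerG_bounded_of_coinvariantBounds
    (S : Finset (HeightOneSpectrum (𝓞 K))) (C : HeightOneSpectrum (𝓞 K) → ℕ)
    (h0 : ∀ [W.IsElliptic], κ.IsCyclotomic →
      (∀ v : HeightOneSpectrum (𝓞 K), (p : 𝓞 K) ∈ v.asIdeal →
        W.HasGoodReductionAt v ∧ W.HasUnitRootAt v) →
      ∀ v ∉ S, ∀ n : ℕ, ∀ g ∈ localSubgroup (κ.layerSubgroup n) (v.adicCompletion K),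
        (∀ U : Subgroup (Field.absoluteGaloisGroup (v.adicCompletion K)),
          IsOpen (U : Set (Field.absoluteGaloisGroup (v.adicCompletion K))) →
            localSubgroup κ.kerSubgroup (v.adicCompletion K) ≤ U → g ∈ U →
              localSubgroup (κ.layerSubgroup n) (v.adicCompletion K) ≤ U) →
        AddCommGroup.primaryComponent
          (FixedPoints.addSubgroup (localSubgroup κ.kerSubgroup (v.adicCompletion K))
              (localPoints W (v.adicCompletion K)) ⧸
            (subOne (localSubgroup κ.kerSubgroup (v.adicCompletion K))
              (localPoints W (v.adicCompletion K)) g).range) p = ⊥)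
    (hC : ∀ [W.IsElliptic], κ.IsCyclotomic →
      (∀ v : HeightOneSpectrum (𝓞 K), (p : 𝓞 K) ∈ v.asIdeal →
        W.HasGoodReductionAt v ∧ W.HasUnitRootAt v) →
      ∀ v ∈ S, ∀ n : ℕ, ∀ g ∈ localSubgroup (κ.layerSubgroup n) (v.adicCompletion K),
        (∀ U : Subgroup (Field.absoluteGaloisGroup (v.adicCompletion K)),
          IsOpen (U : Set (Field.absoluteGaloisGroup (v.adicCompletion K))) →
            localSubgroup κ.kerSubgroup (v.adicCompletion K) ≤ U → g ∈ U →
              localSubgroup (κ.layerSubgroup n) (v.adicCompletion K) ≤ U) →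
        Finite (AddCommGroup.primaryComponent
          (FixedPoints.addSubgroup (localSubgroup κ.kerSubgroup (v.adicCompletion K))
              (localPoints W (v.adicCompletion K)) ⧸
            (subOne (localSubgroup κ.kerSubgroup (v.adicCompletion K))
              (localPoints W (v.adicCompletion K)) g).range) p) ∧
        Nat.card (AddCommGroup.primaryComponent
          (FixedPoints.addSubgroup (localSubgroup κ.kerSubgroup (v.adicCompletion K))
              (localPoints W (v.adicCompletion K)) ⧸
            (subOne (localSubgroup κ.kerSubgroup (v.adicCompletion K))
              (localPoints W (v.adicCompletion K)) g).range) p) ≤ C v) :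
    W.Greenberg1999_kerG_bounded κ := by
  intro _ hκ hp
  have key : ∀ (v : HeightOneSpectrum (𝓞 K)) (n : ℕ),
      (v ∉ S → W.localTowerKerPrimary κ (v.adicCompletion K) n = ⊥) ∧
      (v ∈ S → Finite (W.localTowerKerPrimary κ (v.adicCompletion K) n) ∧
        Nat.card (W.localTowerKerPrimary κ (v.adicCompletion K) n) ≤ C v) := by
    intro v n
    obtain ⟨g, hg, hgen⟩ :=
      ZpExtension.exists_mem_localSubgroup_generate κ (v.adicCompletion K) n
    constructor
    · intro hv
      have hbot := h0 hκ hp v hv n g hg hgen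
      haveI : Finite (AddCommGroup.primaryComponent
          (FixedPoints.addSubgroup (localSubgroup κ.kerSubgroup (v.adicCompletion K))
              (localPoints W (v.adicCompletion K)) ⧸
            (subOne (localSubgroup κ.kerSubgroup (v.adicCompletion K))
              (localPoints W (v.adicCompletion K)) g).range) p) := by
        rw [hbot]; infer_instance
      have hone : Nat.card (AddCommGroup.primaryComponent
          (FixedPoints.addSubgroup (localSubgroup κ.kerSubgroup (v.adicCompletion K))
              (localPoints W (v.adicCompletion K)) ⧸
            (subOne (localSubgroup κ.kerSubgroup (v.adicCompletion K))
              (localPoints W (v.adicCompletion K)) g).range) p) = 1 := by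
        rw [hbot, AddSubgroup.card_bot]
      obtain ⟨hfin, hcard⟩ := W.finite_localTowerKerPrimary_and_card_le κ (v.adicCompletion K)
        n hg hgen
      haveI := hfin
      exact AddSubgroup.eq_bot_of_card_le _ (hcard.trans hone.le)
    · intro hv
      obtain ⟨hfinQ, hcardQ⟩ := hC hκ hp v hv n g hg hgen
      haveI := hfinQ
      obtain ⟨hfin, hcard⟩ := W.finite_localTowerKerPrimary_and_card_le κ (v.adicCompletion K)
        n hg hgen
      exact ⟨hfin, hcard.trans hcardQ⟩
  exact W.exists_forall_finite_kerG_and_card_le_of_localTowerKerBounds κ S C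
    (fun v hv n ↦ (key v n).1 hv) (fun v hv n ↦ (key v n).2 hv)

end Selmer

end WeierstrassCurve
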